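import Mathlib
import Summits.Ventures.DiscreteObjects.Mahler.TraceNu2Structure
import Summits.Ventures.DiscreteObjects.Mahler.SalemSignCertificate

/-!
# `ν = 2` trace certificate from rational sign data (venture `DiscreteObjects`, target L)

Cell `pub-namedobj`, seat `pub-namedobj-mahler` (gen 11). Framing: lottery ticket; floor = certified
bounds/negative ranges.

Wrapper around the structure theorem `nu2_traceLift_certificate` (file `TraceNu2Structure`) taking only
RATIONAL DATA, in the style of `salem_certificate_of_signs`: for a monic `Q ∈ ℤ[X]` of degree `d`,
`d - 2` pairwise disjoint sign-change brackets `(a, b) ⊂ (-2, 2)`, the signs `Q(2) > 0`, `(-1)^d Q(-2) > 0`,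
a rational box `[pL, pU] × [mL, mU]` containing the cofactor values `(h₊, h₋)` — witnessed by
`pL·∏(2 - a) ≤ Q(2) ≤ pU·∏(2 - b)` and `mL·∏(2 + b) ≤ |Q(-2)| ≤ mU·∏(2 + a)` — the non-real criterion on the
box, and rational square-root witnesses `c₁² ≤ pL·mL`, `pU·mU ≤ c₂²`, we get `lo < M(traceLift Q) < hi` as soon
as `lo + lo⁻¹ < (pL + mL + 2c₁)/4 - 2` and `(pU + mU + 2c₂)/4 - 2 < hi + hi⁻¹`.  Every hypothesis is a
`norm_num` fact, so a kernel enclosure of a `ν = 2` census core costs ≈ 50 lines (instances: `CensusDeg10Nu2`, …).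

* `exists_roots_in_intervals` — roots in the brackets (IVT) with the product bounds at `±2`;
* `nu2_certificate_of_signs` — the certificate.
-/

namespace Summit.Ventures.DiscreteObjects.Mahler

open Polynomial

/-! ### The certificate from rational sign data -/

/-- Roots in prescribed disjoint intervals from sign changes, with the product bounds used below. -/
theorem exists_roots_in_intervals {g : ℝ → ℝ} (hg : Continuous g) :
    ∀ I : List (ℝ × ℝ), (∀ ab ∈ I, -2 < ab.1 ∧ ab.1 < ab.2 ∧ ab.2 < 2) →
      I.Pairwise (fun ab cd => ab.2 ≤ cd.1) → (∀ ab ∈ I, g ab.1 * g ab.2 < 0) →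
      ∃ rs : List ℝ, rs.length = I.length ∧ rs.Pairwise (· < ·) ∧
        (∀ r ∈ rs, g r = 0 ∧ ∃ ab ∈ I, ab.1 < r ∧ r < ab.2) ∧
        (rs.map fun r => 2 - r).prod ≤ (I.map fun ab => 2 - ab.1).prod ∧
        (I.map fun ab => 2 - ab.2).prod ≤ (rs.map fun r => 2 - r).prod ∧
        (I.map fun ab => 2 + ab.1).prod ≤ (rs.map fun r => 2 + r).prod ∧
        (rs.map fun r => 2 + r).prod ≤ (I.map fun ab => 2 + ab.2).prod := by
  intro I
  induction I with
  | nil =>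
    intro _ _ _
    exact ⟨[], rfl, List.Pairwise.nil, fun r hr => by simp at hr, by simp, by simp, by simp, by simp⟩
  | cons ab I ih =>
    intro hI hpw hsg
    rw [List.pairwise_cons] at hpw
    obtain ⟨hab, hpw'⟩ := hpw
    obtain ⟨ha, hlt, hb⟩ := hI ab (by simp)
    obtain ⟨r, har, hrb, hgr⟩ := exists_root_of_mul_neg hg hlt (hsg ab (by simp))
    obtain ⟨rs, hlen, hrpw, hroots, hp1, hp2, hp3, hp4⟩ :=
      ih (fun cd hcd => hI cd (List.mem_cons_of_mem ab hcd)) hpw' (fun cd hcd => hsg cd (List.mem_cons_of_mem ab hcd))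
    have hI' : ∀ cd ∈ I, -2 < cd.1 ∧ cd.1 < cd.2 ∧ cd.2 < 2 := fun cd hcd => hI cd (List.mem_cons_of_mem ab hcd)
    have hrs2 : ∀ r' ∈ rs, -2 < r' ∧ r' < 2 := by
      intro r' hr'
      obtain ⟨-, cd, hcd, h1, h2⟩ := hroots r' hr'
      obtain ⟨h3, -, h4⟩ := hI' cd hcd
      exact ⟨by linarith, by linarith⟩
    have hP1 : 0 ≤ (rs.map fun r => 2 - r).prod :=
      List.prod_nonneg fun x hx => by
        obtain ⟨r', hr', rfl⟩ := List.mem_map.mp hx; linarith [(hrs2 r' hr').2]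
    have hP2 : 0 ≤ (I.map fun cd => 2 - cd.2).prod :=
      List.prod_nonneg fun x hx => by
        obtain ⟨cd, hcd, rfl⟩ := List.mem_map.mp hx; linarith [(hI' cd hcd).2.2]
    have hP3 : 0 ≤ (I.map fun cd => 2 + cd.1).prod :=
      List.prod_nonneg fun x hx => by
        obtain ⟨cd, hcd, rfl⟩ := List.mem_map.mp hx; linarith [(hI' cd hcd).1]
    have hP4 : 0 ≤ (rs.map fun r => 2 + r).prod :=
      List.prod_nonneg fun x hx => by
        obtain ⟨r', hr', rfl⟩ := List.mem_map.mp hx; linarith [(hrs2 r' hr').1]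
    refine ⟨r :: rs, by simp [hlen], ?_, ?_, ?_, ?_, ?_, ?_⟩
    · rw [List.pairwise_cons]
      refine ⟨fun r' hr' => ?_, hrpw⟩
      obtain ⟨-, cd, hcd, h1, -⟩ := hroots r' hr'
      have := hab cd hcd
      linarith
    · intro x hx
      rcases List.mem_cons.mp hx with rfl | hx
      · exact ⟨hgr, ab, by simp, har, hrb⟩
      · obtain ⟨h1, cd, hcd, h2, h3⟩ := hroots x hx
        exact ⟨h1, cd, List.mem_cons_of_mem ab hcd, h2, h3⟩
    · simp only [List.map_cons, List.prod_cons]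
      exact mul_le_mul (by linarith) hp1 hP1 (by linarith)
    · simp only [List.map_cons, List.prod_cons]
      exact mul_le_mul (by linarith) hp2 hP2 (by linarith)
    · simp only [List.map_cons, List.prod_cons]
      exact mul_le_mul (by linarith) hp3 hP3 (by linarith)
    · simp only [List.map_cons, List.prod_cons]
      exact mul_le_mul (by linarith) hp4 hP4 (by linarith)

/-- `x ∈ [α, β]` implies `x² ≤ max α² β²` (used for the non-real criterion on a box). -/
theorem sq_le_max_sq_of_mem {x α β : ℝ} (h1 : α ≤ x) (h2 : x ≤ β) : x ^ 2 ≤ max (α ^ 2) (β ^ 2) := by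
  rcases le_or_gt 0 x with hx | hx
  · exact le_max_of_le_right (by nlinarith)
  · exact le_max_of_le_left (by nlinarith)

/-- **`ν = 2` certificate from rational data.**  Let `Q ∈ ℤ[X]` be monic of degree `d`; `I` a list of `d - 2`
pairwise disjoint (sorted) intervals `(a, b) ⊂ (-2, 2)` on each of which `Q` changes sign; `Q(2) > 0` and
`(-1)^d Q(-2) > 0`; and rational numbers `pL ≤ pU`, `mL ≤ mU` with
`pL · ∏(2 - a) ≤ Q(2) ≤ pU · ∏(2 - b)` and `mL · ∏(2 + b) ≤ |Q(-2)| ≤ mU · ∏(2 + a)` (so that the cofactor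
values `h₊ = Q(2)/G(2)`, `h₋ = |Q(-2)|/|G(-2)|` lie in `[pL, pU] × [mL, mU]`), satisfying the non-real criterion
`(mL - pU)², (mU - pL)² < 32 (pL + mL) - 256`.  Then for `lo, hi ≥ 1` and `c₁`, `c₂ ≥ 0` with `c₁² ≤ pL·mL`,
`pU·mU ≤ c₂²`, `lo + lo⁻¹ < (pL + mL + 2c₁)/4 - 2` and `(pU + mU + 2c₂)/4 - 2 < hi + hi⁻¹`:
`lo < M(traceLift Q) < hi`.  Every hypothesis is a rational inequality (`norm_num`). -/
theorem nu2_certificate_of_signs {Q : ℤ[X]} (hQ : Q.Monic) (I : List (ℝ × ℝ))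
    (hlen : I.length + 2 = Q.natDegree)
    (hI : ∀ ab ∈ I, -2 < ab.1 ∧ ab.1 < ab.2 ∧ ab.2 < 2)
    (hsorted : I.Pairwise (fun ab cd => ab.2 ≤ cd.1))
    (hsign : ∀ ab ∈ I, aeval ab.1 Q * aeval ab.2 Q < 0)
    (hQ2 : 0 < aeval (2 : ℝ) Q) (hQm2 : 0 < (-1) ^ Q.natDegree * aeval (-2 : ℝ) Q)
    {pL pU mL mU : ℝ} (hpL0 : 0 ≤ pL) (hmL0 : 0 ≤ mL)
    (hpL : pL * (I.map fun ab => 2 - ab.1).prod ≤ aeval (2 : ℝ) Q)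
    (hpU : aeval (2 : ℝ) Q ≤ pU * (I.map fun ab => 2 - ab.2).prod)
    (hmL : mL * (I.map fun ab => 2 + ab.2).prod ≤ |aeval (-2 : ℝ) Q|)
    (hmU : |aeval (-2 : ℝ) Q| ≤ mU * (I.map fun ab => 2 + ab.1).prod)
    (hcrit₁ : (mL - pU) ^ 2 < 32 * (pL + mL) - 256) (hcrit₂ : (mU - pL) ^ 2 < 32 * (pL + mL) - 256)
    {lo hi c₁ c₂ : ℝ} (hlo : 1 ≤ lo) (hhi : 1 ≤ hi)
    (hc₁' : c₁ ^ 2 ≤ pL * mL) (hlow : lo + lo⁻¹ < (pL + mL + 2 * c₁) / 4 - 2)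
    (hc₂ : 0 ≤ c₂) (hc₂' : pU * mU ≤ c₂ ^ 2) (hupp : (pU + mU + 2 * c₂) / 4 - 2 < hi + hi⁻¹) :
    lo < intMahlerMeasure (traceLift Q) ∧ intMahlerMeasure (traceLift Q) < hi := by
  classical
  set g : ℝ → ℝ := fun y => aeval y Q with hgdef
  have hg : Continuous g := by
    rw [hgdef]; simp only [← eval_map_algebraMap]; exact Polynomial.continuous _
  obtain ⟨rs, hrslen, hrspw, hroots, hp1, hp2, hp3, hp4⟩ := exists_roots_in_intervals hg I hI hsorted hsign
  have hrs2 : ∀ r ∈ rs, -2 < r ∧ r < 2 := by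
    intro r hr
    obtain ⟨-, cd, hcd, h1, h2⟩ := hroots r hr
    obtain ⟨h3, -, h4⟩ := hI cd hcd
    exact ⟨by linarith, by linarith⟩
  set T : Multiset ℝ := (rs : Multiset ℝ) with hT
  have hTnodup : T.Nodup := Multiset.coe_nodup.mpr (hrspw.imp ne_of_lt)
  have hTcard : Multiset.card T + 2 = Q.natDegree := by rw [hT, Multiset.coe_card, hrslen, hlen]
  have hTroot : ∀ t ∈ T, aeval t Q = 0 := fun t ht => (hroots t (Multiset.mem_coe.mp ht)).1
  have hTin : ∀ t ∈ T, -2 < t ∧ t < 2 := fun t ht => hrs2 t (Multiset.mem_coe.mp ht)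
  -- the products
  have hGp : (T.map fun t => 2 - t).prod = (rs.map fun r => 2 - r).prod := by
    rw [hT, Multiset.map_coe, Multiset.prod_coe]
  have hGm' : (T.map fun t => 2 + t).prod = (rs.map fun r => 2 + r).prod := by
    rw [hT, Multiset.map_coe, Multiset.prod_coe]
  have hGneg : (T.map fun t => -2 - t).prod = (-1) ^ rs.length * (T.map fun t => 2 + t).prod := by
    have : (T.map fun t => -2 - t) = (T.map fun t => 2 + t).map Neg.neg := by
      rw [Multiset.map_map]; exact Multiset.map_congr rfl fun t _ => by simp only [Function.comp_apply]; ring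
    rw [this, Multiset.prod_map_neg, Multiset.card_map, hT, Multiset.coe_card]
  have hGp_pos : 0 < (T.map fun t => 2 - t).prod :=
    Multiset.prod_pos fun a ha => by
      obtain ⟨t, ht, rfl⟩ := Multiset.mem_map.mp ha; linarith [(hTin t ht).2]
  have hGm_pos : 0 < (T.map fun t => 2 + t).prod :=
    Multiset.prod_pos fun a ha => by
      obtain ⟨t, ht, rfl⟩ := Multiset.mem_map.mp ha; linarith [(hTin t ht).1]
  -- `h₊`, `h₋`
  set hp : ℝ := aeval (2 : ℝ) Q / (T.map fun t => 2 - t).prod with hhpdef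
  set hm : ℝ := |aeval (-2 : ℝ) Q| / (T.map fun t => 2 + t).prod with hhmdef
  have hhp : hp * (T.map fun t => 2 - t).prod = aeval (2 : ℝ) Q := div_mul_cancel₀ _ hGp_pos.ne'
  have habs : |aeval (-2 : ℝ) Q| = (-1) ^ Q.natDegree * aeval (-2 : ℝ) Q := by
    rw [← abs_of_pos hQm2, abs_mul, abs_pow, abs_neg, abs_one, one_pow, one_mul]
  have hhm : hm * (T.map fun t => -2 - t).prod = aeval (-2 : ℝ) Q := by
    rw [hGneg, mul_comm ((-1 : ℝ) ^ rs.length), ← mul_assoc, div_mul_cancel₀ _ hGm_pos.ne', habs,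
      mul_comm, ← mul_assoc, ← pow_add, hrslen, ← hlen]
    rw [show I.length + (I.length + 2) = 2 * (I.length + 1) by ring, pow_mul]
    norm_num
  -- the box
  have hpU0 : 0 < pU := by
    have h0 : 0 < pU * (I.map fun ab => 2 - ab.2).prod := lt_of_lt_of_le hQ2 hpU
    have hP : 0 ≤ (I.map fun ab => 2 - ab.2).prod :=
      List.prod_nonneg fun x hx => by obtain ⟨cd, hcd, rfl⟩ := List.mem_map.mp hx; linarith [(hI cd hcd).2.2]
    by_contra hneg
    have : pU * (I.map fun ab => 2 - ab.2).prod ≤ 0 := mul_nonpos_of_nonpos_of_nonneg (not_lt.mp hneg) hP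
    linarith
  have hQm2abs : 0 < |aeval (-2 : ℝ) Q| := by rw [habs]; exact hQm2
  have hmU0 : 0 < mU := by
    have h0 : 0 < mU * (I.map fun ab => 2 + ab.1).prod := lt_of_lt_of_le hQm2abs hmU
    have hP : 0 ≤ (I.map fun ab => 2 + ab.1).prod :=
      List.prod_nonneg fun x hx => by obtain ⟨cd, hcd, rfl⟩ := List.mem_map.mp hx; linarith [(hI cd hcd).1]
    by_contra hneg
    have : mU * (I.map fun ab => 2 + ab.1).prod ≤ 0 := mul_nonpos_of_nonpos_of_nonneg (not_lt.mp hneg) hP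
    linarith
  have hpL' : pL ≤ hp := by
    rw [le_div_iff₀ hGp_pos, hGp]
    calc pL * (rs.map fun r => 2 - r).prod ≤ pL * (I.map fun ab => 2 - ab.1).prod :=
          mul_le_mul_of_nonneg_left hp1 hpL0
      _ ≤ aeval 2 Q := hpL
  have hpU' : hp ≤ pU := by
    rw [div_le_iff₀ hGp_pos, hGp]
    calc (aeval 2 Q : ℝ) ≤ pU * (I.map fun ab => 2 - ab.2).prod := hpU
      _ ≤ pU * (rs.map fun r => 2 - r).prod := mul_le_mul_of_nonneg_left hp2 hpU0.le
  have hmL' : mL ≤ hm := by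
    rw [le_div_iff₀ hGm_pos, hGm']
    calc mL * (rs.map fun r => 2 + r).prod ≤ mL * (I.map fun ab => 2 + ab.2).prod :=
          mul_le_mul_of_nonneg_left hp4 hmL0
      _ ≤ |aeval (-2) Q| := hmL
  have hmU' : hm ≤ mU := by
    rw [div_le_iff₀ hGm_pos, hGm']
    calc |(aeval (-2) Q : ℝ)| ≤ mU * (I.map fun ab => 2 + ab.1).prod := hmU
      _ ≤ mU * (rs.map fun r => 2 + r).prod := mul_le_mul_of_nonneg_left hp3 hmU0.le
  have hcrit : (hm - hp) ^ 2 < 32 * (hp + hm) - 256 := by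
    have h1 := sq_le_max_sq_of_mem (x := hm - hp) (α := mL - pU) (β := mU - pL) (by linarith) (by linarith)
    have h2 : max ((mL - pU) ^ 2) ((mU - pL) ^ 2) < 32 * (pL + mL) - 256 := max_lt hcrit₁ hcrit₂
    linarith
  obtain ⟨hM1, hMM⟩ := nu2_traceLift_certificate hQ T hTnodup hTcard hTroot hTin hhp hhm hcrit
  have hM0 : 0 < intMahlerMeasure (traceLift Q) := by linarith
  have hhp0 : 0 ≤ hp := le_trans hpL0 hpL'
  have hhm0 : 0 ≤ hm := le_trans hmL0 hmL'
  constructor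
  · have hs : c₁ ≤ Real.sqrt (hp * hm) :=
      Real.le_sqrt_of_sq_le (le_trans hc₁' (mul_le_mul hpL' hmL' hmL0 hhp0))
    have h : lo + lo⁻¹ < intMahlerMeasure (traceLift Q) + (intMahlerMeasure (traceLift Q))⁻¹ := by
      rw [hMM]; linarith
    exact lt_of_add_inv_lt_add_inv hM1.le (by linarith) h
  · have hs : Real.sqrt (hp * hm) ≤ c₂ := by
      rw [← Real.sqrt_sq hc₂]
      exact Real.sqrt_le_sqrt (le_trans (mul_le_mul hpU' hmU' hhm0 hpU0.le) hc₂')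
    have h : intMahlerMeasure (traceLift Q) + (intMahlerMeasure (traceLift Q))⁻¹ < hi + hi⁻¹ := by
      rw [hMM]; linarith
    exact lt_of_add_inv_lt_add_inv hhi hM0 h

end Summit.Ventures.DiscreteObjects.Mahler
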